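import Literature.RepresentationTheory.PolynomialPlaceIsotypic
import Literature.Analysis.SegalBargmann.FockInfinitesimalAction
import Mathlib.LinearAlgebra.PiTensorProduct.Basic
import HarnessLib

/-!
# Block-diagonal substitutions place by place: `K_∞ = ∏_v K_v`-isotypic Fock polynomials are sums of products of homogeneous per-place isotypic polynomials

Topic `Analysis/SegalBargmann`; namespace `Literature.Analysis.SegalBargmann`.  The Fock variables of several
archimedean places are `κ × o` (`κ` the local variables, `o` the places; the tree's `Weil1964.placeBlock` convention),
and a place-by-place compact element `k = (k_v)_v` acts on `ℂ[z_{κ × o}]` by the substitution `linSubst (star M)` with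
`M = Matrix.blockDiagonal (v ↦ ρ_v k_v)`.

* §1 `linSubst (blockDiagonal M)` acts slot by slot: on `rename (·, v) p` it is `rename (·, v) (linSubst (M v) p)`
  (`linSubst_blockDiagonal_rename_atPlace`), on place products factorwise (`linSubst_blockDiagonal_prod`), and for a
  single-place family `Pi.mulSingle v A` it is `placeMap v (linSubst A)` of `RepresentationTheory/PolynomialPlaceIsotypic`
  (`linSubst_blockDiagonal_mulSingle`); `star` of a block-diagonal matrix (`star_blockDiagonal`).
* §2 `linSubst` commutes with the homogeneous components (`homogeneousComponent_linSubst`); hence the homogeneous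
  components of a substitution eigenvector are eigenvectors (`smul_linSubst_homogeneousComponent`).
* §3 for per-place homomorphisms `ρ_v : K_v →* U(κ)` and multiplicative weights / eigencharacters
  `z_v, c_v : K_v →* ℂ` (`z_v` nowhere zero): a polynomial `G` with
  `(∏_v z_v k_v) • linSubst (star (blockDiagonal (ρ_v k_v))) G = (∏_v c_v k_v) • G` for all `k ∈ ∏_v K_v` is
  place-isotypic (`isPlaceIsotypic_of_forall_blockDiagonal`, by the single-place elements `Pi.mulSingle v t`), hence
  (`PolynomialPlaceIsotypic.mem_span_placeProducts_of_isPlaceIsotypic` + §2) a finite combination of products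
  `∏_v rename (·, v) p_v` of HOMOGENEOUS per-place eigenvectors `z_v t • (p_v ∘ (ρ_v t)⁻¹) = c_v t • p_v`
  (**`mem_span_homPlaceProducts`**); conversely every such product satisfies the `K_∞`-equations
  (`forall_blockDiagonal_of_homPlaceProduct`) and is homogeneous; so the two spans agree
  (`span_isotypic_eq_span_homPlaceProducts`, stated for any family of unitaries `U k` whose matrices are the
  block-diagonal ones, e.g. `Weil1964.placeBlock`).
* §4 the place-product multilinear map `(p_v)_v ↦ ∏_v rename (·, v) p_v`, its lift `placeTensorLift` to
  `⨂_v ℂ[z_κ]` (Mathlib `PiTensorProduct.lift`), and for per-place linear embeddings `emb_v : M_v →ₗ ℂ[z_κ]` of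
  printed local models the insertion `placeTensorIns emb : (⨂_v M_v) →ₗ ℂ[z_{κ × o}]` (`placeTensorIns_tprod`,
  `range_placeTensorIns`); if every `emb_v` lands in per-place eigenvectors, the whole range satisfies the
  `K_∞`-equations (`forall_blockDiagonal_of_mem_range_placeTensorIns`).

Folklore bookkeeping (outer tensor products of isotypic components, Goodman–Wallach GTM 255 §4.2.1) specialised to
the Fock model; use (pub-hodgecm model cell, rows A12/A34, field `dense`): with `SchwartzIsotypicFockPolynomials` the
archimedean `κ`-isotypic Schwartz space is the closure of the span of `binvPi` of these place products, whose factors the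
per-place classifications list.  Everything is proved; no cited fact.

Provenance: LEAN-IN-TREE rule (2026-08-18), pub-hodgecm model-construction sub-cell, seat mc-binder-2 gen 5; KERNEL only.
[folklore]
-/

set_option autoImplicit false

noncomputable section

open MvPolynomial Literature.RepresentationTheory
open scoped BigOperators

namespace Literature.Analysis.SegalBargmann

variable {κ : Type*} [Fintype κ] [DecidableEq κ] {o : Type*} [Fintype o] [DecidableEq o]

/-! ## §1  `linSubst` of block-diagonal matrices -/

section Block

omit [DecidableEq κ] in
/-- **Slot by slot**: `linSubst (blockDiagonal M) (rename (·, v) p) = rename (·, v) (linSubst (M v) p)`. [folklore] -/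
theorem linSubst_blockDiagonal_rename_atPlace (M : o → Matrix κ κ ℂ) (v : o) (p : MvPolynomial κ ℂ) :
    linSubst (Matrix.blockDiagonal M) (rename (atPlace v) p) = rename (atPlace v) (linSubst (M v) p) := by
  have h : (linSubst (Matrix.blockDiagonal M)).comp (rename (atPlace (κ := κ) v)) =
      (rename (atPlace v)).comp (linSubst (M v)) :=
    MvPolynomial.algHom_ext fun i => by
      rw [AlgHom.comp_apply, AlgHom.comp_apply, rename_X, linSubst_X, linSubst_X, map_sum, Fintype.sum_prod_type]
      refine Finset.sum_congr rfl fun j _ => ?_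
      rw [map_mul, rename_C, rename_X, Finset.sum_eq_single v]
      · rw [Matrix.blockDiagonal_apply_eq]
      · intro w _ hw
        rw [Matrix.blockDiagonal_apply_ne _ _ _ (Ne.symm hw), C_0, zero_mul]
      · exact fun hv => (hv (Finset.mem_univ v)).elim
  exact AlgHom.congr_fun h p

omit [DecidableEq κ] in
/-- **Factorwise on place products.** [folklore] -/
theorem linSubst_blockDiagonal_prod (M : o → Matrix κ κ ℂ) (p : o → MvPolynomial κ ℂ) :
    linSubst (Matrix.blockDiagonal M) (∏ v, rename (atPlace v) (p v)) =
      ∏ v, rename (atPlace v) (linSubst (M v) (p v)) := by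
  rw [map_prod]
  exact Finset.prod_congr rfl fun v _ => linSubst_blockDiagonal_rename_atPlace M v (p v)

/-- **A single-place block family is `placeMap`**: `linSubst (blockDiagonal (mulSingle v A)) = placeMap v (linSubst A)`.
[folklore] -/
theorem linSubst_blockDiagonal_mulSingle (v : o) (A : Matrix κ κ ℂ) :
    linSubst (Matrix.blockDiagonal (Pi.mulSingle v A : o → Matrix κ κ ℂ)) = placeMap v (linSubst A) :=
  MvPolynomial.algHom_ext fun p => by
    obtain ⟨i, w⟩ := p
    rw [show (X (i, w) : MvPolynomial (κ × o) ℂ) = rename (atPlace w) (X i) by rw [rename_X],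
      linSubst_blockDiagonal_rename_atPlace]
    by_cases hw : w = v
    · subst hw
      rw [Pi.mulSingle_eq_same, placeMap_rename_same]
    · rw [Pi.mulSingle_eq_of_ne hw, linSubst_one_apply, placeMap_rename_other hw]

omit [Fintype κ] [DecidableEq κ] [Fintype o] in
/-- `star (blockDiagonal M) = blockDiagonal (star ∘ M)`. [folklore] -/
theorem star_blockDiagonal (M : o → Matrix κ κ ℂ) :
    star (Matrix.blockDiagonal M) = Matrix.blockDiagonal fun v => star (M v) := by
  simp only [Matrix.star_eq_conjTranspose, Matrix.blockDiagonal_conjTranspose]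

end Block

/-! ## §2  Homogeneous components of substitution eigenvectors -/

section Homogeneous

omit [DecidableEq κ] in
/-- **`linSubst` commutes with the homogeneous components.** [folklore] -/
theorem homogeneousComponent_linSubst (A : Matrix κ κ ℂ) (d : ℕ) (p : MvPolynomial κ ℂ) :
    homogeneousComponent d (linSubst A p) = linSubst A (homogeneousComponent d p) := by
  conv_lhs => rw [← sum_homogeneousComponent p]
  rw [map_sum, map_sum]
  have h : ∀ e, homogeneousComponent d (linSubst A (homogeneousComponent e p)) =
      if d = e then linSubst A (homogeneousComponent e p) else 0 := fun e =>
    homogeneousComponent_of_mem ((mem_homogeneousSubmodule e _).mpr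
      (isHomogeneous_linSubst A (homogeneousComponent_isHomogeneous e p)))
  simp_rw [h]
  rw [Finset.sum_ite_eq]
  split_ifs with hd
  · rfl
  · rw [homogeneousComponent_eq_zero, map_zero]
    rw [Finset.mem_range, not_lt] at hd
    omega

omit [DecidableEq κ] in
/-- **The homogeneous components of a substitution eigenvector are eigenvectors** (same weight, same eigenvalue).
[folklore] -/
theorem smul_linSubst_homogeneousComponent {A : Matrix κ κ ℂ} {z c : ℂ} {p : MvPolynomial κ ℂ}
    (h : z • linSubst A p = c • p) (d : ℕ) :
    z • linSubst A (homogeneousComponent d p) = c • homogeneousComponent d p := by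
  have h' := congrArg (homogeneousComponent d) h
  rwa [LinearMap.map_smul, LinearMap.map_smul, homogeneousComponent_linSubst] at h'

end Homogeneous

/-! ## §3  `∏_v K_v`-isotypic polynomials -/

section Places

variable {Kv : o → Type*} [∀ v, Group (Kv v)]
  (ρ : ∀ v, Kv v →* Matrix.unitaryGroup κ ℂ) (z c : ∀ v, Kv v →* ℂ)

/-- The block-diagonal matrix of `k = (k_v)_v`. [folklore] -/
def blockMat (k : ∀ v, Kv v) : Matrix (κ × o) (κ × o) ℂ :=
  Matrix.blockDiagonal fun v => ((ρ v (k v) : Matrix.unitaryGroup κ ℂ) : Matrix κ κ ℂ)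

/-- The product weight `∏_v z_v k_v`. [folklore] -/
def prodChar (z : ∀ v, Kv v →* ℂ) (k : ∀ v, Kv v) : ℂ := ∏ v, z v (k v)

omit [Fintype o] in
/-- At a single-place element the block matrix is the single-place family. [folklore] -/
theorem blockMat_mulSingle (v : o) (t : Kv v) :
    blockMat ρ (Pi.mulSingle v t) =
      Matrix.blockDiagonal (Pi.mulSingle v ((ρ v t : Matrix.unitaryGroup κ ℂ) : Matrix κ κ ℂ)) := by
  unfold blockMat
  congr 1
  funext w
  by_cases hw : w = v
  · subst hw; rw [Pi.mulSingle_eq_same, Pi.mulSingle_eq_same]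
  · rw [Pi.mulSingle_eq_of_ne hw, Pi.mulSingle_eq_of_ne hw, map_one]; rfl

omit [Fintype o] in
/-- `star` of the single-place block matrix. [folklore] -/
theorem star_blockMat_mulSingle (v : o) (t : Kv v) :
    star (blockMat ρ (Pi.mulSingle v t)) =
      Matrix.blockDiagonal (Pi.mulSingle v (star ((ρ v t : Matrix.unitaryGroup κ ℂ) : Matrix κ κ ℂ))) := by
  rw [blockMat_mulSingle, star_blockDiagonal]
  congr 1
  funext w
  by_cases hw : w = v
  · subst hw; rw [Pi.mulSingle_eq_same, Pi.mulSingle_eq_same]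
  · rw [Pi.mulSingle_eq_of_ne hw, Pi.mulSingle_eq_of_ne hw]
    exact star_one (Matrix κ κ ℂ)

/-- The product weight at a single-place element. [folklore] -/
theorem prodChar_mulSingle (v : o) (t : Kv v) : prodChar z (Pi.mulSingle v t) = z v t := by
  rw [prodChar, Finset.prod_eq_single v]
  · rw [Pi.mulSingle_eq_same]
  · intro w _ hw; rw [Pi.mulSingle_eq_of_ne hw, map_one]
  · exact fun hv => (hv (Finset.mem_univ v)).elim

/-- **`K_∞`-isotypic ⇒ place-isotypic** (restriction to the single-place elements `Pi.mulSingle v (k v)`; index type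
`T = ∏_v K_v` read through the `v`-component; per-place eigenvalue `(z_v k_v)⁻¹ c_v k_v`). [folklore] -/
theorem isPlaceIsotypic_of_forall_blockDiagonal (hz : ∀ v t, z v t ≠ 0) {G : MvPolynomial (κ × o) ℂ}
    (hG : ∀ k : ∀ v, Kv v, prodChar z k • linSubst (star (blockMat ρ k)) G = prodChar c k • G) :
    IsPlaceIsotypic
      (fun v (k : ∀ w, Kv w) => linSubst (star ((ρ v (k v) : Matrix.unitaryGroup κ ℂ) : Matrix κ κ ℂ)))
      (fun v k => (z v (k v))⁻¹ * c v (k v)) G := by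
  intro v k
  have h := hG (Pi.mulSingle v (k v))
  rw [prodChar_mulSingle, prodChar_mulSingle, star_blockMat_mulSingle, linSubst_blockDiagonal_mulSingle] at h
  rw [mul_smul, ← h, smul_smul, inv_mul_cancel₀ (hz v (k v)), one_smul]

/-- **The products of HOMOGENEOUS per-place eigenvectors.** [folklore] -/
def homPlaceProducts : Set (MvPolynomial (κ × o) ℂ) :=
  {F | ∃ p : o → MvPolynomial κ ℂ,
    (∀ v, (∃ d, (p v).IsHomogeneous d) ∧
      ∀ t : Kv v, z v t • linSubst (star ((ρ v t : Matrix.unitaryGroup κ ℂ) : Matrix κ κ ℂ)) (p v) = c v t • p v) ∧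
    F = ∏ v, rename (atPlace v) (p v)}

/-- **Main theorem: a `K_∞`-isotypic polynomial is a finite combination of products of homogeneous per-place
eigenvectors.** [folklore] -/
theorem mem_span_homPlaceProducts (hz : ∀ v t, z v t ≠ 0) {G : MvPolynomial (κ × o) ℂ}
    (hG : ∀ k : ∀ v, Kv v, prodChar z k • linSubst (star (blockMat ρ k)) G = prodChar c k • G) :
    G ∈ Submodule.span ℂ (homPlaceProducts ρ z c) := by
  have hiso := isPlaceIsotypic_of_forall_blockDiagonal ρ z c hz hG
  have hmem := mem_span_placeProducts_of_isPlaceIsotypic _ _ hiso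
  refine (Submodule.span_le.mpr ?_) hmem
  -- each place product of eigenvectors is a combination of products of HOMOGENEOUS eigenvectors
  rintro _ ⟨p, hp, rfl⟩
  have hpv : ∀ v (t : Kv v),
      z v t • linSubst (star ((ρ v t : Matrix.unitaryGroup κ ℂ) : Matrix κ κ ℂ)) (p v) = c v t • p v := by
    intro v t
    have h := mem_jointEigenspace.mp (hp v) (Pi.mulSingle v t)
    simp only [AlgHom.toLinearMap_apply, Pi.mulSingle_eq_same] at h
    rw [h, smul_smul, mul_inv_cancel_left₀ (hz v t)]
  -- expand every factor into homogeneous components and distribute the product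
  have hexp : ∏ v, rename (atPlace v) (p v) =
      ∏ v, ∑ e ∈ Finset.range ((p v).totalDegree + 1), rename (atPlace v) (homogeneousComponent e (p v)) :=
    Finset.prod_congr rfl fun v _ => by rw [← map_sum, sum_homogeneousComponent]
  rw [SetLike.mem_coe, hexp, Finset.prod_univ_sum]
  refine Submodule.sum_mem _ fun d _ => Submodule.subset_span ⟨fun v => homogeneousComponent (d v) (p v),
    fun v => ⟨⟨d v, homogeneousComponent_isHomogeneous _ _⟩, fun t =>
      smul_linSubst_homogeneousComponent (hpv v t) (d v)⟩, rfl⟩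

/-- **Conversely, a product of per-place eigenvectors satisfies every `K_∞`-equation.** [folklore] -/
theorem forall_blockDiagonal_of_placeProduct (hz : ∀ v t, z v t ≠ 0) (p : o → MvPolynomial κ ℂ)
    (hp : ∀ v (t : Kv v),
      z v t • linSubst (star ((ρ v t : Matrix.unitaryGroup κ ℂ) : Matrix κ κ ℂ)) (p v) = c v t • p v)
    (k : ∀ v, Kv v) :
    prodChar z k • linSubst (star (blockMat ρ k)) (∏ v, rename (atPlace v) (p v)) =
      prodChar c k • ∏ v, rename (atPlace v) (p v) := by
  have hpv : ∀ v, linSubst (star ((ρ v (k v) : Matrix.unitaryGroup κ ℂ) : Matrix κ κ ℂ)) (p v) =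
      ((z v (k v))⁻¹ * c v (k v)) • p v := fun v => by
    rw [mul_smul, ← hp v (k v), smul_smul, inv_mul_cancel₀ (hz v (k v)), one_smul]
  rw [blockMat, star_blockDiagonal, linSubst_blockDiagonal_prod]
  simp_rw [hpv, map_smul]
  rw [Finset.prod_smul, smul_smul, prodChar, prodChar, ← Finset.prod_mul_distrib]
  congr 1
  exact Finset.prod_congr rfl fun v _ => by rw [mul_inv_cancel_left₀ (hz v (k v))]

omit [Fintype κ] [DecidableEq κ] [DecidableEq o] [∀ v, Group (Kv v)] in
/-- A product of homogeneous polynomials placed at the places is homogeneous. [folklore] -/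
theorem isHomogeneous_placeProduct (p : o → MvPolynomial κ ℂ) (d : o → ℕ) (hp : ∀ v, (p v).IsHomogeneous (d v)) :
    (∏ v, rename (atPlace v) (p v)).IsHomogeneous (∑ v, d v) :=
  IsHomogeneous.prod _ _ _ fun v _ => (hp v).rename_isHomogeneous

/-- **The two spans agree**: for any family of unitaries `U k ∈ U(κ × o)` with block-diagonal matrices
`blockDiagonal (ρ_v k_v)` (e.g. `Weil1964.placeBlock`), the span of the HOMOGENEOUS `K_∞`-isotypic polynomials
(`SchwartzIsotypicFockPolynomials.isotypicFockPolys` shape) is the span of the homogeneous place products. [folklore] -/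
theorem span_isotypic_eq_span_homPlaceProducts (hz : ∀ v t, z v t ≠ 0)
    (U : (∀ v, Kv v) → Matrix.unitaryGroup (κ × o) ℂ)
    (hU : ∀ k, ((U k : Matrix.unitaryGroup (κ × o) ℂ) : Matrix (κ × o) (κ × o) ℂ) = blockMat ρ k) :
    Submodule.span ℂ {G : MvPolynomial (κ × o) ℂ | (∃ d, G.IsHomogeneous d) ∧
        ∀ k, prodChar z k • linSubst (star ((U k : Matrix.unitaryGroup (κ × o) ℂ) : Matrix (κ × o) (κ × o) ℂ)) G =
          prodChar c k • G} =
      Submodule.span ℂ (homPlaceProducts ρ z c) := by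
  refine le_antisymm (Submodule.span_le.mpr ?_) (Submodule.span_mono ?_)
  · rintro G ⟨-, hG⟩
    exact mem_span_homPlaceProducts ρ z c hz fun k => by rw [← hU]; exact hG k
  · rintro _ ⟨p, hp, rfl⟩
    refine ⟨⟨∑ v, (hp v).1.choose, isHomogeneous_placeProduct p _ fun v => (hp v).1.choose_spec⟩, fun k => ?_⟩
    rw [hU]
    exact forall_blockDiagonal_of_placeProduct ρ z c hz p (fun v => (hp v).2) k

end Places

/-! ## §4  The place-product multilinear map and the printed insertion `⨂_v M_v → ℂ[z_{κ × o}]` -/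

section Tensor

open scoped TensorProduct

/-- **`(p_v)_v ↦ ∏_v rename (·, v) p_v` is multilinear.** [folklore] -/
def placeProdMultilinear : MultilinearMap ℂ (fun _ : o => MvPolynomial κ ℂ) (MvPolynomial (κ × o) ℂ) :=
  (MultilinearMap.mkPiAlgebra ℂ o (MvPolynomial (κ × o) ℂ)).compLinearMap fun v =>
    (rename (atPlace (κ := κ) v)).toLinearMap

omit [Fintype κ] [DecidableEq κ] [DecidableEq o] in
/-- Its value. [folklore] -/
@[simp] theorem placeProdMultilinear_apply (p : o → MvPolynomial κ ℂ) :
    placeProdMultilinear p = ∏ v, rename (atPlace v) (p v) := by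
  rw [placeProdMultilinear, MultilinearMap.compLinearMap_apply, MultilinearMap.mkPiAlgebra_apply]
  rfl

/-- **The lift to the tensor product** `⨂_v ℂ[z_κ] →ₗ ℂ[z_{κ × o}]`. [folklore] -/
def placeTensorLift : (⨂[ℂ] _v : o, MvPolynomial κ ℂ) →ₗ[ℂ] MvPolynomial (κ × o) ℂ :=
  PiTensorProduct.lift placeProdMultilinear

omit [Fintype κ] [DecidableEq κ] [DecidableEq o] in
/-- On pure tensors: the place product. [folklore] -/
@[simp] theorem placeTensorLift_tprod (p : o → MvPolynomial κ ℂ) :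
    placeTensorLift (PiTensorProduct.tprod ℂ p) = ∏ v, rename (atPlace v) (p v) := by
  rw [placeTensorLift, PiTensorProduct.lift.tprod, placeProdMultilinear_apply]

variable {M : o → Type*} [∀ v, AddCommGroup (M v)] [∀ v, Module ℂ (M v)]

/-- **The printed insertion**: per-place linear embeddings `emb_v : M_v →ₗ ℂ[z_κ]` followed by the place product,
`(⨂_v M_v) →ₗ ℂ[z_{κ × o}]`. [folklore] -/
def placeTensorIns (emb : ∀ v, M v →ₗ[ℂ] MvPolynomial κ ℂ) : (⨂[ℂ] v, M v) →ₗ[ℂ] MvPolynomial (κ × o) ℂ :=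
  placeTensorLift.comp (PiTensorProduct.map emb)

omit [Fintype κ] [DecidableEq κ] [DecidableEq o] in
/-- On pure tensors. [folklore] -/
@[simp] theorem placeTensorIns_tprod (emb : ∀ v, M v →ₗ[ℂ] MvPolynomial κ ℂ) (m : ∀ v, M v) :
    placeTensorIns emb (PiTensorProduct.tprod ℂ m) = ∏ v, rename (atPlace v) (emb v (m v)) := by
  rw [placeTensorIns, LinearMap.comp_apply, PiTensorProduct.map_tprod, placeTensorLift_tprod]

omit [Fintype κ] [DecidableEq κ] [DecidableEq o] in
/-- **The range of the insertion is spanned by the place products of embedded vectors.** [folklore] -/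
theorem range_placeTensorIns (emb : ∀ v, M v →ₗ[ℂ] MvPolynomial κ ℂ) :
    LinearMap.range (placeTensorIns emb) =
      Submodule.span ℂ {F | ∃ m : ∀ v, M v, F = ∏ v, rename (atPlace v) (emb v (m v))} := by
  rw [LinearMap.range_eq_map, ← PiTensorProduct.span_tprod_eq_top, Submodule.map_span]
  congr 1
  ext F
  simp only [Set.mem_image, Set.mem_range, Set.mem_setOf_eq]
  constructor
  · rintro ⟨_, ⟨m, rfl⟩, rfl⟩
    exact ⟨m, placeTensorIns_tprod emb m⟩
  · rintro ⟨m, rfl⟩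
    exact ⟨_, ⟨m, rfl⟩, placeTensorIns_tprod emb m⟩

variable {Kv : o → Type*} [∀ v, Group (Kv v)]
  (ρ : ∀ v, Kv v →* Matrix.unitaryGroup κ ℂ) (z c : ∀ v, Kv v →* ℂ)

/-- **If every embedding lands in per-place eigenvectors, the whole range satisfies the `K_∞`-equations.**
[folklore] -/
theorem forall_blockDiagonal_of_mem_range_placeTensorIns (hz : ∀ v t, z v t ≠ 0)
    (emb : ∀ v, M v →ₗ[ℂ] MvPolynomial κ ℂ)
    (hemb : ∀ v (x : M v) (t : Kv v),
      z v t • linSubst (star ((ρ v t : Matrix.unitaryGroup κ ℂ) : Matrix κ κ ℂ)) (emb v x) = c v t • emb v x)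
    {F : MvPolynomial (κ × o) ℂ} (hF : F ∈ LinearMap.range (placeTensorIns emb)) (k : ∀ v, Kv v) :
    prodChar z k • linSubst (star (blockMat ρ k)) F = prodChar c k • F := by
  rw [range_placeTensorIns] at hF
  induction hF using Submodule.span_induction with
  | mem G hG =>
    obtain ⟨m, rfl⟩ := hG
    exact forall_blockDiagonal_of_placeProduct ρ z c hz (fun v => emb v (m v)) (fun v t => hemb v (m v) t) k
  | zero => simp only [map_zero, smul_zero]
  | add G₁ G₂ _ _ h₁ h₂ => rw [map_add, smul_add, h₁, h₂, smul_add]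
  | smul a G _ h => rw [map_smul, smul_comm, h, smul_comm]

end Tensor

end Literature.Analysis.SegalBargmann

end
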